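import Summits.QuantumFields.QCD.Theses.PauliWegnerSea

/-!
# Crux `TiltedFlatness` (K3 of `PauliWegnerSea`), negative side — two-sided circles are load-bearing in `FibreSmallBalls`

Support file of the standing disprover (gen 2) of item stmt-QuantumFields-14070, written against the
picked line `circle-transport` (skeleton r2b).  Its abstract Haar small-ball stub `FibreSmallBalls`
(`stub_haarSmallBalls`, the lead's) asks the band limit of `F²` along the TWO-SIDED circles
`t ↦ W[r i ↦ A·T(t)·B]`, `A, B ∈ SU(3)`, `T(t) = diag(e^{it}, e^{-it}, 1)`.

**Theorem `not_fibreSmallBalls_oneSided`.**  With the band limit asked only along the ONE-SIDED circles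
`W(r i)·T(t)` and `T(t)·W(r i)` (the literal shape of the route's `PauliBandLimit`), the statement is
FALSE already at degree `D = 0` with one coordinate: `F(W) = max(0, 1 − 2‖W(e)₀₀‖²)` is continuous,
`≥ 0`, CONSTANT along every one-sided diagonal circle (they only re-phase the entry `W(e)₀₀`), `= 1` at
the signed permutation `swap` (`swap₀₀ = 0`) and `= 0` on the Haar-open set `{‖g₀₀‖² > 1/2} ∋ 1`; hence
`Haar{F ≤ ε F(W₀)} ≥ Haar{‖g₀₀‖² > 1/2} > 0` for every `ε > 0`, and no bound `C ε^c` exists.  Moral for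
the lead: any proof of `stub_haarSmallBalls` must use the conjugators (`B ≠ 1`, i.e. the letters
`V T V⁻¹` of `stub_eulerWord`); one-sided translates of one circle never leave a torus coset.
Standard material. [folklore]
-/

open MeasureTheory Set Filter
open Literature.MathematicalPhysics.QuantumFieldTheory Literature.MathematicalPhysics.QuantumLattice
  Literature.Probability.LatticeModels

namespace Summit.QuantumFields.QCD.Theorems.TiltedFlatnessNegative

/-- The signed permutation matrix `swap = [[0,1,0],[-1,0,0],[0,0,1]]` (vanishing `(0,0)` entry) is special unitary. [folklore] -/
theorem swap_mem_specialUnitaryGroup :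
    !![(0:ℂ), 1, 0; -1, 0, 0; 0, 0, 1] ∈ Matrix.specialUnitaryGroup (Fin 3) ℂ := by
  rw [Matrix.mem_specialUnitaryGroup_iff, Matrix.mem_unitaryGroup_iff]
  constructor
  · ext i j
    fin_cases i <;> fin_cases j <;>
      simp [Matrix.mul_apply, Fin.sum_univ_three, Matrix.star_eq_conjTranspose]
  · simp [Matrix.det_fin_three]

/-- Entries of a special unitary matrix have norm `≤ 1`. [folklore] -/
theorem entry_norm_le_one (g : (Matrix.specialUnitaryGroup (Fin 3) ℂ)) (i j : Fin 3) : ‖(g : Matrix (Fin 3) (Fin 3) ℂ) i j‖ ≤ 1 := by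
  have := g.2
  rw [Matrix.mem_specialUnitaryGroup_iff] at this
  exact entry_norm_bound_of_unitary this.1 i j

/-- Right multiplication by the diagonal circle `diag(e^{it}, e^{-it}, 1)` does not change `‖g₀₀‖`. [folklore] -/
theorem norm_mul_diag_00 (T : ℝ → (Matrix.specialUnitaryGroup (Fin 3) ℂ))
    (hT : ∀ θ : ℝ, ((T θ : (Matrix.specialUnitaryGroup (Fin 3) ℂ)) : Matrix (Fin 3) (Fin 3) ℂ) =
      Matrix.diagonal ![Complex.exp (θ * Complex.I), Complex.exp (-(θ * Complex.I)), 1])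
    (g : (Matrix.specialUnitaryGroup (Fin 3) ℂ)) (t : ℝ) :
    ‖((g * T t : (Matrix.specialUnitaryGroup (Fin 3) ℂ)) : Matrix (Fin 3) (Fin 3) ℂ) 0 0‖ = ‖(g : Matrix (Fin 3) (Fin 3) ℂ) 0 0‖ := by
  have hmul : ((g * T t : (Matrix.specialUnitaryGroup (Fin 3) ℂ)) : Matrix (Fin 3) (Fin 3) ℂ) = (g : Matrix (Fin 3) (Fin 3) ℂ) * (T t : (Matrix.specialUnitaryGroup (Fin 3) ℂ)) :=
    rfl
  rw [hmul, hT t, Matrix.mul_apply, Fin.sum_univ_three]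
  simp [Matrix.diagonal, Complex.norm_exp_ofReal_mul_I]

/-- Left multiplication by the diagonal circle `diag(e^{it}, e^{-it}, 1)` does not change `‖g₀₀‖`. [folklore] -/
theorem norm_diag_mul_00 (T : ℝ → (Matrix.specialUnitaryGroup (Fin 3) ℂ))
    (hT : ∀ θ : ℝ, ((T θ : (Matrix.specialUnitaryGroup (Fin 3) ℂ)) : Matrix (Fin 3) (Fin 3) ℂ) =
      Matrix.diagonal ![Complex.exp (θ * Complex.I), Complex.exp (-(θ * Complex.I)), 1])
    (g : (Matrix.specialUnitaryGroup (Fin 3) ℂ)) (t : ℝ) :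
    ‖((T t * g : (Matrix.specialUnitaryGroup (Fin 3) ℂ)) : Matrix (Fin 3) (Fin 3) ℂ) 0 0‖ = ‖(g : Matrix (Fin 3) (Fin 3) ℂ) 0 0‖ := by
  have hmul : ((T t * g : (Matrix.specialUnitaryGroup (Fin 3) ℂ)) : Matrix (Fin 3) (Fin 3) ℂ) = ((T t : (Matrix.specialUnitaryGroup (Fin 3) ℂ)) : Matrix (Fin 3) (Fin 3) ℂ) * g :=
    rfl
  rw [hmul, hT t, Matrix.mul_apply, Fin.sum_univ_three]
  simp [Matrix.diagonal, Complex.norm_exp_ofReal_mul_I]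

/-- **Two-sidedness of the circles is load-bearing in `FibreSmallBalls`.**  If the band-limit
hypothesis of the abstract Haar small-ball statement is asked only along the ONE-SIDED circles
`t ↦ W[r i ↦ W(r i)·T(t)]` and `t ↦ W[r i ↦ T(t)·W(r i)]` (instead of `A·T(t)·B` for all `A, B`), the
statement is FALSE already for `D = 0`, `n = 1`: `F(W) = max(0, 1 − 2‖W(e)₀₀‖²)` is continuous, `≥ 0`,
CONSTANT along all one-sided diagonal circles (they only rephase the entry), positive at the signed
permutation, and vanishes on the Haar-open set `{‖g₀₀‖² > 1/2} ∋ 1`, so `Haar{F ≤ ε F(W₀)}` does not tend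
to `0`.  (Any proof of `stub_haarSmallBalls` must use conjugated circles `V T V⁻¹`, i.e. `B ≠ 1`.) [folklore] -/
theorem not_fibreSmallBalls_oneSided (T : ℝ → (Matrix.specialUnitaryGroup (Fin 3) ℂ))
    (hT : ∀ θ : ℝ, ((T θ : (Matrix.specialUnitaryGroup (Fin 3) ℂ)) : Matrix (Fin 3) (Fin 3) ℂ) =
      Matrix.diagonal ![Complex.exp (θ * Complex.I), Complex.exp (-(θ * Complex.I)), 1]) :
    ¬ (∀ (D n : ℕ), ∃ C c : ℝ, 0 < C ∧ 0 < c ∧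
      ∀ (E : Type) [Fintype E] [DecidableEq E] (ι : Type) [Fintype ι] (r : ι → E), Fintype.card ι ≤ n →
      ∀ F : (E → (Matrix.specialUnitaryGroup (Fin 3) ℂ)) → ℝ, Continuous F → (∀ W, 0 ≤ F W) →
        (∀ W W' : E → (Matrix.specialUnitaryGroup (Fin 3) ℂ), (∀ i, W (r i) = W' (r i)) → F W = F W') →
        (∀ (W : E → (Matrix.specialUnitaryGroup (Fin 3) ℂ)) (i : ι),
          (∃ a : ℤ → ℂ, ∀ t : ℝ,
            ((F (Function.update W (r i) (W (r i) * T t)) ^ 2 : ℝ) : ℂ) =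
              ∑ k ∈ Finset.Icc (-(D : ℤ)) D, a k * Complex.exp ((k : ℂ) * (t : ℂ) * Complex.I)) ∧
          (∃ a : ℤ → ℂ, ∀ t : ℝ,
            ((F (Function.update W (r i) (T t * W (r i))) ^ 2 : ℝ) : ℂ) =
              ∑ k ∈ Finset.Icc (-(D : ℤ)) D, a k * Complex.exp ((k : ℂ) * (t : ℂ) * Complex.I))) →
        ∀ W₀ : E → (Matrix.specialUnitaryGroup (Fin 3) ℂ), 0 < F W₀ → ∀ ε : ℝ, 0 < ε →
          ((Measure.pi fun _ : E => haarProbability (Matrix.specialUnitaryGroup (Fin 3) ℂ)) {W | F W ≤ ε * F W₀}).toReal ≤ C * ε ^ c) := by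
  intro H
  obtain ⟨C, c, hC, hc, H⟩ := H 0 1
  -- the witness on one coordinate
  let φ : (Matrix.specialUnitaryGroup (Fin 3) ℂ) → ℝ := fun g => max 0 (1 - 2 * ‖(g : Matrix (Fin 3) (Fin 3) ℂ) 0 0‖ ^ 2)
  let F : (Fin 1 → (Matrix.specialUnitaryGroup (Fin 3) ℂ)) → ℝ := fun W => φ (W 0)
  have hφ_cont : Continuous φ :=
    continuous_const.max (continuous_const.sub (continuous_const.mul
      ((continuous_norm.comp ((continuous_apply_apply 0 0).comp continuous_subtype_val)).pow 2)))
  have hF_cont : Continuous F := hφ_cont.comp (continuous_apply 0)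
  have hF_nn : ∀ W, 0 ≤ F W := fun W => le_max_left _ _
  have hF_dep : ∀ W W' : Fin 1 → (Matrix.specialUnitaryGroup (Fin 3) ℂ), (∀ i : Fin 1, W (id i) = W' (id i)) → F W = F W' := by
    intro W W' h
    show φ (W 0) = φ (W' 0)
    rw [← show W (id 0) = W 0 from rfl, h 0]
    rfl
  have hIcc : Finset.Icc (-((0 : ℕ) : ℤ)) ((0 : ℕ) : ℤ) = {0} := by decide
  have hF_bl : ∀ (W : Fin 1 → (Matrix.specialUnitaryGroup (Fin 3) ℂ)) (i : Fin 1),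
      (∃ a : ℤ → ℂ, ∀ t : ℝ,
        ((F (Function.update W (id i) (W (id i) * T t)) ^ 2 : ℝ) : ℂ) =
          ∑ k ∈ Finset.Icc (-((0 : ℕ) : ℤ)) ((0 : ℕ) : ℤ), a k * Complex.exp ((k : ℂ) * (t : ℂ) * Complex.I)) ∧
      (∃ a : ℤ → ℂ, ∀ t : ℝ,
        ((F (Function.update W (id i) (T t * W (id i))) ^ 2 : ℝ) : ℂ) =
          ∑ k ∈ Finset.Icc (-((0 : ℕ) : ℤ)) ((0 : ℕ) : ℤ), a k * Complex.exp ((k : ℂ) * (t : ℂ) * Complex.I)) := by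
    intro W i
    obtain rfl : i = 0 := Subsingleton.elim i 0
    refine ⟨⟨fun _ => ((φ (W 0) ^ 2 : ℝ) : ℂ), fun t => ?_⟩, ⟨fun _ => ((φ (W 0) ^ 2 : ℝ) : ℂ), fun t => ?_⟩⟩
    · rw [hIcc, Finset.sum_singleton]
      simp only [Int.cast_zero, zero_mul, Complex.exp_zero, mul_one]
      show (((φ (Function.update W 0 (W 0 * T t) 0)) ^ 2 : ℝ) : ℂ) = _
      rw [Function.update_self]
      simp only [φ, norm_mul_diag_00 T hT]
    · rw [hIcc, Finset.sum_singleton]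
      simp only [Int.cast_zero, zero_mul, Complex.exp_zero, mul_one]
      show (((φ (Function.update W 0 (T t * W 0) 0)) ^ 2 : ℝ) : ℂ) = _
      rw [Function.update_self]
      simp only [φ, norm_diag_mul_00 T hT]
  -- the reference point: the signed permutation, `F = 1`
  let P : (Matrix.specialUnitaryGroup (Fin 3) ℂ) := ⟨!![(0:ℂ), 1, 0; -1, 0, 0; 0, 0, 1], swap_mem_specialUnitaryGroup⟩
  let W₀ : Fin 1 → (Matrix.specialUnitaryGroup (Fin 3) ℂ) := fun _ => P
  have hFW₀ : F W₀ = 1 := by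
    show max 0 (1 - 2 * ‖(!![(0:ℂ), 1, 0; -1, 0, 0; 0, 0, 1] : Matrix (Fin 3) (Fin 3) ℂ) 0 0‖ ^ 2) = 1
    simp
  have hW₀ : 0 < F W₀ := by rw [hFW₀]; exact one_pos
  -- the Haar-open set where `F = 0`
  let V : Set (Matrix.specialUnitaryGroup (Fin 3) ℂ) := {g | 1 / 2 < ‖(g : Matrix (Fin 3) (Fin 3) ℂ) 0 0‖ ^ 2}
  have hV_open : IsOpen V :=
    isOpen_lt continuous_const
      ((continuous_norm.comp ((continuous_apply_apply 0 0).comp continuous_subtype_val)).pow 2)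
  have h1V : (1 : (Matrix.specialUnitaryGroup (Fin 3) ℂ)) ∈ V := by
    show 1 / 2 < ‖((1 : (Matrix.specialUnitaryGroup (Fin 3) ℂ)) : Matrix (Fin 3) (Fin 3) ℂ) 0 0‖ ^ 2
    norm_num
  let μ : Measure (Fin 1 → (Matrix.specialUnitaryGroup (Fin 3) ℂ)) := Measure.pi fun _ => haarProbability (Matrix.specialUnitaryGroup (Fin 3) ℂ)
  haveI : (haarProbability (Matrix.specialUnitaryGroup (Fin 3) ℂ)).IsOpenPosMeasure := by unfold haarProbability; infer_instance
  haveI : IsProbabilityMeasure μ := by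
    show IsProbabilityMeasure (Measure.pi fun _ : Fin 1 => haarProbability (Matrix.specialUnitaryGroup (Fin 3) ℂ)); infer_instance
  have hVpos : 0 < haarProbability (Matrix.specialUnitaryGroup (Fin 3) ℂ) V := hV_open.measure_pos _ ⟨1, h1V⟩
  have hVfin : haarProbability (Matrix.specialUnitaryGroup (Fin 3) ℂ) V ≠ ⊤ := measure_ne_top _ _
  set v : ℝ := (haarProbability (Matrix.specialUnitaryGroup (Fin 3) ℂ) V).toReal with hv
  have hv0 : 0 < v := ENNReal.toReal_pos hVpos.ne' hVfin
  -- for every `ε > 0` the sublevel set has mass `≥ v`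
  have hfloor : ∀ ε : ℝ, 0 < ε → v ≤ (μ {W | F W ≤ ε * F W₀}).toReal := by
    intro ε hε
    have hsub : Set.pi Set.univ (fun _ : Fin 1 => V) ⊆ {W | F W ≤ ε * F W₀} := by
      intro W hW
      have h0 : W 0 ∈ V := hW 0 (Set.mem_univ _)
      have h0' : 1 / 2 < ‖((W 0 : (Matrix.specialUnitaryGroup (Fin 3) ℂ)) : Matrix (Fin 3) (Fin 3) ℂ) 0 0‖ ^ 2 := h0
      have hF0 : F W = 0 := by
        show max 0 (1 - 2 * ‖((W 0 : (Matrix.specialUnitaryGroup (Fin 3) ℂ)) : Matrix (Fin 3) (Fin 3) ℂ) 0 0‖ ^ 2) = 0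
        exact max_eq_left (by linarith)
      show F W ≤ ε * F W₀
      rw [hF0, hFW₀]; linarith
    have hpi : μ (Set.pi Set.univ (fun _ : Fin 1 => V)) = haarProbability (Matrix.specialUnitaryGroup (Fin 3) ℂ) V := by
      show (Measure.pi fun _ : Fin 1 => haarProbability (Matrix.specialUnitaryGroup (Fin 3) ℂ)) (Set.pi Set.univ (fun _ : Fin 1 => V)) = _
      rw [Measure.pi_pi]
      simp
    rw [hv, ← hpi]
    exact ENNReal.toReal_mono (measure_ne_top _ _) (measure_mono hsub)
  -- choose `ε` with `C ε^c ≤ v/2`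
  set q : ℝ := v / (2 * C) with hq
  have hq0 : 0 < q := by positivity
  set ε : ℝ := q ^ (1 / c) with hε
  have hε0 : 0 < ε := Real.rpow_pos_of_pos hq0 _
  have hεc : ε ^ c = q := by
    rw [hε, ← Real.rpow_mul hq0.le, one_div, inv_mul_cancel₀ hc.ne', Real.rpow_one]
  have key := H (Fin 1) (Fin 1) id (by simp) F hF_cont hF_nn hF_dep hF_bl W₀ hW₀ ε hε0
  have := (hfloor ε hε0).trans key
  rw [hεc, hq] at this
  have : C * (v / (2 * C)) = v / 2 := by field_simp
  linarith

end Summit.QuantumFields.QCD.Theorems.TiltedFlatnessNegative
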